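import Summits.FinalStateConjecture.FinalStateConjecture.Theorems.PhotonSphereChannelsWindowedShellChannelsPerModeCore
import Summits.FinalStateConjecture.FinalStateConjecture.Theorems.PhotonSphereChannelsWindowedShellChannelsStubUnitMass
import Summits.FinalStateConjecture.FinalStateConjecture.Theorems.PhotonSphereChannelsWindowedShellChannelsStubRecentre
import Summits.FinalStateConjecture.FinalStateConjecture.Theorems.PhotonSphereChannelsWindowedShellChannelsStubFiniteEnergy

/-!
# Crux `WindowedShellChannels` (stmt-FinalStateConjecture-14085) REDUCED TO ITS SINGLE SEMICLASSICAL STUB: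
# `stub_coreHigh` (all σ) ⇒ `WindowedShellChannels`

With the per-mode residue `stub_coreMode` a theorem (file `…PerModeCore`, all six pieces of line `Sketch`
landed), the crux follows from the ONE remaining registered stub of the line, the ℓ-uniform semiclassical
escape `stub_coreHigh σ` (high angular numbers, caught-form), by the glue proved by the line leads:
`core_of_split` (lead c2, skeleton v5: one `(h, c)` per `ρ` for ALL modes — the semiclassical stub above
`ℓ₀(ρ)`, the per-mode theorem on the finitely many modes below, `h = h_high + Σ h_{s,ℓ}`,
`1/c = 1/c_high + Σ 1/c_{s,ℓ}`), then unit mass ⇒ recentring ⇒ finite energy ⇒ parity regrading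
(the four landed reductions `WindowedShellChannelsStubs.stub_unitMass/recentre/finiteEnergy/parity`).
`windowedShellChannels_of_coreHigh` records this kernel-checked: the crux is EXACTLY as hard as
`stub_coreHigh`.  No definitions; the hypothesis is the registered stub's statement quantified over the
parity `σ` (only `σ = ±1` are used). [new]
-/

noncomputable section

set_option linter.dupNamespace false

namespace Summit.FinalStateConjecture.FinalStateConjecture.Theorems.WindowedShellChannelsSketch

open Literature.Geometry.Lorentzian Literature.Geometry.Lorentzian.ReggeWheeler
open Summit.FinalStateConjecture.FinalStateConjecture.Theses.PhotonSphereChannels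
open Summit.FinalStateConjecture.FinalStateConjecture.Theorems.WindowedShellChannelsStubs
open Filter Set MeasureTheory
open scoped ENNReal Topology

/-- GLUE (lead c2, skeleton v5, reproduced verbatim): ONE `(h, c)` per `ρ` for ALL modes from a high-mode
statement above `ℓ₀(ρ)` and a per-mode statement on the finitely many modes below it. [new] -/
theorem core_of_split (σ : ℝ) (Hh : ∀ ρ : ℝ, 0 < ρ → ∃ ℓ₀ : ℕ, ∃ h : ℝ, 0 ≤ h ∧ ∃ c : ℝ, 0 < c ∧
    ∀ (s ℓ : ℕ), s ≤ 2 → s ≤ ℓ → ℓ₀ ≤ ℓ → ∀ ψ : ℝ → ℝ → ℝ,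
        IsRWSolution 1 s ℓ (tortoiseRadius one_pos 0) ψ → (∀ t x, ψ (-t) x = σ * ψ t x) →
        CauchyDataSupportedOn ψ {x : ℝ | ρ < |x|} →
        totalEnergy (linePotential 1 s ℓ (tortoiseRadius one_pos 0)) ψ 0 ≠ ⊤ →
          ENNReal.ofReal c * totalEnergy (linePotential 1 s ℓ (tortoiseRadius one_pos 0)) ψ 0 ≤
            channelEnergy (linePotential 1 s ℓ (tortoiseRadius one_pos 0)) 0 (ρ - h) ψ atTop)
    (Hm : ∀ ρ : ℝ, 0 < ρ → ∀ (s ℓ : ℕ), s ≤ 2 → s ≤ ℓ → ∃ h : ℝ, 0 ≤ h ∧ ∃ c : ℝ, 0 < c ∧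
    ∀ ψ : ℝ → ℝ → ℝ,
        IsRWSolution 1 s ℓ (tortoiseRadius one_pos 0) ψ → (∀ t x, ψ (-t) x = σ * ψ t x) →
        CauchyDataSupportedOn ψ {x : ℝ | ρ < |x|} →
        totalEnergy (linePotential 1 s ℓ (tortoiseRadius one_pos 0)) ψ 0 ≠ ⊤ →
          ENNReal.ofReal c * totalEnergy (linePotential 1 s ℓ (tortoiseRadius one_pos 0)) ψ 0 ≤
            channelEnergy (linePotential 1 s ℓ (tortoiseRadius one_pos 0)) 0 (ρ - h) ψ atTop) :
    ∀ ρ : ℝ, 0 < ρ → ∃ h : ℝ, 0 ≤ h ∧ ∃ c : ℝ, 0 < c ∧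
    ∀ (s ℓ : ℕ), s ≤ 2 → s ≤ ℓ → ∀ ψ : ℝ → ℝ → ℝ,
        IsRWSolution 1 s ℓ (tortoiseRadius one_pos 0) ψ → (∀ t x, ψ (-t) x = σ * ψ t x) →
        CauchyDataSupportedOn ψ {x : ℝ | ρ < |x|} →
        totalEnergy (linePotential 1 s ℓ (tortoiseRadius one_pos 0)) ψ 0 ≠ ⊤ →
          ENNReal.ofReal c * totalEnergy (linePotential 1 s ℓ (tortoiseRadius one_pos 0)) ψ 0 ≤
            channelEnergy (linePotential 1 s ℓ (tortoiseRadius one_pos 0)) 0 (ρ - h) ψ atTop := by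
  intro ρ hρ
  classical
  obtain ⟨ℓ₀, hh, hhh, ch, hch, Hh'⟩ := Hh ρ hρ
  have Hm' := Hm ρ hρ
  -- choice functions on all pairs `(s, ℓ)` (dummy values off the admissible pairs)
  let hf : ℕ → ℕ → ℝ := fun s ℓ => if h : s ≤ 2 ∧ s ≤ ℓ then (Hm' s ℓ h.1 h.2).choose else 0
  let cf : ℕ → ℕ → ℝ := fun s ℓ =>
    if h : s ≤ 2 ∧ s ≤ ℓ then (Hm' s ℓ h.1 h.2).choose_spec.2.choose else 1
  have hhf : ∀ s ℓ, 0 ≤ hf s ℓ := by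
    intro s ℓ
    by_cases h : s ≤ 2 ∧ s ≤ ℓ
    · simp only [hf, dif_pos h]
      exact (Hm' s ℓ h.1 h.2).choose_spec.1
    · simp only [hf, dif_neg h, le_refl]
  have hcf : ∀ s ℓ, 0 < cf s ℓ := by
    intro s ℓ
    by_cases h : s ≤ 2 ∧ s ≤ ℓ
    · simp only [cf, dif_pos h]
      exact (Hm' s ℓ h.1 h.2).choose_spec.2.choose_spec.1
    · simp only [cf, dif_neg h, zero_lt_one]
  set hsum : ℝ := ∑ s' ∈ Finset.range 3, ∑ ℓ' ∈ Finset.range ℓ₀, hf s' ℓ' with hhsum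
  set csum : ℝ := ∑ s' ∈ Finset.range 3, ∑ ℓ' ∈ Finset.range ℓ₀, (cf s' ℓ')⁻¹ with hcsum
  have hhsum0 : 0 ≤ hsum :=
    Finset.sum_nonneg fun s' _ => Finset.sum_nonneg fun ℓ' _ => hhf s' ℓ'
  have hcsum0 : 0 ≤ csum :=
    Finset.sum_nonneg fun s' _ => Finset.sum_nonneg fun ℓ' _ => (inv_pos.2 (hcf s' ℓ')).le
  have hX : 0 < ch⁻¹ + csum := add_pos_of_pos_of_nonneg (inv_pos.2 hch) hcsum0
  refine ⟨hh + hsum, add_nonneg hhh hhsum0, (ch⁻¹ + csum)⁻¹, inv_pos.2 hX, ?_⟩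
  intro s ℓ hs hsℓ ψ hψ hpar hsupp hE
  by_cases hℓ : ℓ₀ ≤ ℓ
  · -- high modes
    have key := Hh' s ℓ hs hsℓ hℓ ψ hψ hpar hsupp hE
    have hc_le : (ch⁻¹ + csum)⁻¹ ≤ ch := by
      rw [inv_le_comm₀ hX hch]
      exact le_add_of_nonneg_right hcsum0
    calc ENNReal.ofReal (ch⁻¹ + csum)⁻¹ * totalEnergy (linePotential 1 s ℓ (tortoiseRadius one_pos 0)) ψ 0
        ≤ ENNReal.ofReal ch * totalEnergy (linePotential 1 s ℓ (tortoiseRadius one_pos 0)) ψ 0 :=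
          mul_le_mul' (ENNReal.ofReal_le_ofReal hc_le) le_rfl
      _ ≤ channelEnergy (linePotential 1 s ℓ (tortoiseRadius one_pos 0)) 0 (ρ - hh) ψ atTop := key
      _ ≤ channelEnergy (linePotential 1 s ℓ (tortoiseRadius one_pos 0)) 0 (ρ - (hh + hsum)) ψ atTop :=
          Parity.channelEnergy_mono_aperture _ 0 (by linarith) ψ atTop
  · -- low modes
    replace hℓ := not_le.1 hℓ
    have hval : s ≤ 2 ∧ s ≤ ℓ := ⟨hs, hsℓ⟩
    have hhf_eq : hf s ℓ = (Hm' s ℓ hs hsℓ).choose := by simp only [hf, dif_pos hval]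
    have hcf_eq : cf s ℓ = (Hm' s ℓ hs hsℓ).choose_spec.2.choose := by simp only [cf, dif_pos hval]
    have hspec := (Hm' s ℓ hs hsℓ).choose_spec.2.choose_spec
    have key := hspec.2 ψ hψ hpar hsupp hE
    have hs3 : s ∈ Finset.range 3 := Finset.mem_range.2 (by omega)
    have hℓr : ℓ ∈ Finset.range ℓ₀ := Finset.mem_range.2 hℓ
    have hh_le : (Hm' s ℓ hs hsℓ).choose ≤ hh + hsum := by
      rw [← hhf_eq]
      have h1' : hf s ℓ ≤ ∑ ℓ' ∈ Finset.range ℓ₀, hf s ℓ' :=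
        Finset.single_le_sum (f := fun ℓ' => hf s ℓ') (fun ℓ' _ => hhf s ℓ') hℓr
      have h2' : (∑ ℓ' ∈ Finset.range ℓ₀, hf s ℓ') ≤ hsum :=
        Finset.single_le_sum (f := fun s' => ∑ ℓ' ∈ Finset.range ℓ₀, hf s' ℓ')
          (fun s' _ => Finset.sum_nonneg fun ℓ' _ => hhf s' ℓ') hs3
      linarith
    have hc_le : (ch⁻¹ + csum)⁻¹ ≤ (Hm' s ℓ hs hsℓ).choose_spec.2.choose := by
      rw [← hcf_eq, inv_le_comm₀ hX (hcf s ℓ)]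
      have h1' : (cf s ℓ)⁻¹ ≤ ∑ ℓ' ∈ Finset.range ℓ₀, (cf s ℓ')⁻¹ :=
        Finset.single_le_sum (f := fun ℓ' => (cf s ℓ')⁻¹) (fun ℓ' _ => (inv_pos.2 (hcf s ℓ')).le) hℓr
      have h2' : (∑ ℓ' ∈ Finset.range ℓ₀, (cf s ℓ')⁻¹) ≤ csum :=
        Finset.single_le_sum (f := fun s' => ∑ ℓ' ∈ Finset.range ℓ₀, (cf s' ℓ')⁻¹)
          (fun s' _ => Finset.sum_nonneg fun ℓ' _ => (inv_pos.2 (hcf s' ℓ')).le) hs3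
      have h3' : 0 < ch⁻¹ := inv_pos.2 hch
      linarith
    calc ENNReal.ofReal (ch⁻¹ + csum)⁻¹ * totalEnergy (linePotential 1 s ℓ (tortoiseRadius one_pos 0)) ψ 0
        ≤ ENNReal.ofReal (Hm' s ℓ hs hsℓ).choose_spec.2.choose * totalEnergy (linePotential 1 s ℓ (tortoiseRadius one_pos 0)) ψ 0 :=
          mul_le_mul' (ENNReal.ofReal_le_ofReal hc_le) le_rfl
      _ ≤ channelEnergy (linePotential 1 s ℓ (tortoiseRadius one_pos 0)) 0 (ρ - (Hm' s ℓ hs hsℓ).choose) ψ atTop := key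
      _ ≤ channelEnergy (linePotential 1 s ℓ (tortoiseRadius one_pos 0)) 0 (ρ - (hh + hsum)) ψ atTop :=
          Parity.channelEnergy_mono_aperture _ 0 (by linarith) ψ atTop


/-- **The crux modulo its semiclassical stub.**  If the ℓ-uniform high-mode escape `stub_coreHigh σ` holds
for every parity `σ` (registered stub of line `Sketch`; only `σ = ±1` are used), then
`WindowedShellChannels` holds: `core_of_split σ (Hh σ) (stub_coreMode σ)` for `σ = ±1`, then the four
landed reductions. [new] -/
theorem windowedShellChannels_of_coreHigh
    (Hh : ∀ σ : ℝ, ∀ ρ : ℝ, 0 < ρ → ∃ ℓ₀ : ℕ, ∃ h : ℝ, 0 ≤ h ∧ ∃ c : ℝ, 0 < c ∧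
      ∀ (s ℓ : ℕ), s ≤ 2 → s ≤ ℓ → ℓ₀ ≤ ℓ → ∀ ψ : ℝ → ℝ → ℝ,
        IsRWSolution 1 s ℓ (tortoiseRadius one_pos 0) ψ → (∀ t x, ψ (-t) x = σ * ψ t x) →
        CauchyDataSupportedOn ψ {x : ℝ | ρ < |x|} →
        totalEnergy (linePotential 1 s ℓ (tortoiseRadius one_pos 0)) ψ 0 ≠ ⊤ →
          ENNReal.ofReal c * totalEnergy (linePotential 1 s ℓ (tortoiseRadius one_pos 0)) ψ 0 ≤
            channelEnergy (linePotential 1 s ℓ (tortoiseRadius one_pos 0)) 0 (ρ - h) ψ atTop) :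
    WindowedShellChannels := by
  have He := stub_finiteEnergy 1 (stub_recentre 1 (stub_unitMass 1
    (core_of_split 1 (Hh 1) (stub_coreMode 1))))
  have Ho := stub_finiteEnergy (-1) (stub_recentre (-1) (stub_unitMass (-1)
    (core_of_split (-1) (Hh (-1)) (stub_coreMode (-1)))))
  refine stub_parity ?_ ?_
  · intro M hM ρ hρ
    obtain ⟨h, hh, c, hc, H⟩ := He M hM ρ hρ
    exact ⟨h, hh, c, hc, fun r xc hr s ℓ hs hsℓ ψ hψ hpar hsupp =>
      H r xc hr s ℓ hs hsℓ ψ hψ (fun t x => by rw [one_mul]; exact hpar t x) hsupp⟩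
  · intro M hM ρ hρ
    obtain ⟨h, hh, c, hc, H⟩ := Ho M hM ρ hρ
    exact ⟨h, hh, c, hc, fun r xc hr s ℓ hs hsℓ ψ hψ hpar hsupp =>
      H r xc hr s ℓ hs hsℓ ψ hψ (fun t x => by rw [neg_one_mul]; exact hpar t x) hsupp⟩

end Summit.FinalStateConjecture.FinalStateConjecture.Theorems.WindowedShellChannelsSketch

end
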